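import Summits.ValiantsHypothesis.ValiantsHypothesis.Theorems.DivisionGapPerDivisionHardStubTorusSplit

/-!
# Crux `DivisionGap.PerDivisionHard` (stmt-ValiantsHypothesis-5065), line
`pair-descent-jss-endpoint` (v14) — stub `stub_torusCellSplit`: the torus normal form WITHIN a
cell-split class

For a set `Y ⊆ [n] × [n]` of cells of the matrix, a CELL-SPLIT cofactor is
`h = Σ_{t < W} f_t · g_t` with every `f_t` in the variables `x_e`, `e ∈ Y`, and every `g_t` in the
variables `x_e`, `e ∉ Y` (rank `≤ W` across the partition `Y ⊔ Yᶜ` of the variables, Nisan–Raz).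
The `Y`-CONTENT of a monomial `m` is the pair `Φ_Y(m) = (rowContent_Y m, colContent_Y m)`,
`rowContent_Y m r = Σ_{c : (r,c) ∈ Y} m (r,c)` and `colContent_Y m c = Σ_{r : (r,c) ∈ Y} m (r,c)`.
`stub_torusCellSplit`: if such an `h` is nonzero, some nonzero TORUS-HOMOGENEOUS `h'`
(`IsTorusHomogeneous`) costs no more in either monotone complexity (`L(per_n · h') ≤ L(per_n · h)`,
`L(h') ≤ L(h)`, the tree's fan-in-two `complexity` over `ℝ≥0`) AND its monomials have at most `W`
distinct `Y`-contents.  This is the template `stub_torusSplit`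
(`Theorems/DivisionGapPerDivisionHardStubTorusSplit.lean`, the case `Y = A × [n]`) verbatim for a
general cell set.

Proof.  (1) Two torus steps WITHIN the class (`exists_topComponent_const_margins_split`, the
template's `exists_topComponent_const_margins_rowSplit` for arbitrary monomial classes `P`, `Q` of
the two factors): by `topComponent_sum_mul` the top component of a split sum is a split sum over
the same index set whose factors have smaller supports (`exists_rowSplit_topComponent`), so the
variable constraints persist; the digit weights of `Prod.fst`/`Prod.snd` make the margins
constant (`mapDomain_eq_of_mem_support_topComponent`) and cost nothing
(`complexity_topComponent_le`, `isWeightedHomogeneous_perPoly_digitWeight`).  (2) THE BOUND: for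
a monomial `a` on the cells of `Y` and a monomial `b` off them, `Φ_Y(a + b)` is the pair of margin
vectors of `a` (`rowContent_add_of_cellSplit`, `colContent_add_of_cellSplit`); for two monomials
`a + b`, `a' + b'` of one summand `F_t · G_t` of the final split sum `h'` the cross sum `a' + b` is
a monomial of `h'` too (`support_mul_eq`, no cancellation over `ℝ≥0`), so torus homogeneity of `h'`
and cancellation in `ℕ^n` give `a`, `a'` the same margins (`cellContentPair_const_on_summand`).
Hence `Φ_Y` is constant on the support of every one of the `W` summands
(`card_image_le_of_const_on_summands`). [folklore]
-/

noncomputable section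

-- `Summit.ValiantsHypothesis.ValiantsHypothesis.…` is the tree's mandated single-conjunct layout
-- (Sub = Summit), so the duplicated namespace component is intended.
set_option linter.dupNamespace false

namespace Summit.ValiantsHypothesis.ValiantsHypothesis.Theorems.DivisionGapPerDivisionHard

open MvPolynomial Literature.Computability.AlgebraicComplexity
open Literature.Barriers.ValiantsHypothesis
open Summit.ValiantsHypothesis.ValiantsHypothesis.Theorems.ZeroOneTransfer.Negative
open scoped NNReal Pointwise

variable {n : ℕ}

/-! ### One degeneration step within a split class -/

/-- **One torus step within a split class.**  For a nonzero split sum `Σ_t F_t · G_t` whose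
factors `F_t` have all their monomials in a class `P` and whose factors `G_t` have all their
monomials in a class `Q`, and for the digit weight of `f` (radix `deg + 1`), the top component is
again such a split sum `Σ_t F'_t · G'_t` over the same index set (supports of the factors only
shrink, `exists_rowSplit_topComponent`), nonzero, with support inside that of the sum, with
constant `f`-margins, and it costs nothing: `L(per · Σ F' G') ≤ L(per · Σ F G)` and
`L(Σ F' G') ≤ L(Σ F G)` (the template's `exists_topComponent_const_margins_rowSplit` for general
monomial classes). [folklore] -/
theorem exists_topComponent_const_margins_split (f : Fin n × Fin n → Fin n)
    (hf : ∀ (B : ℕ) (π : Equiv.Perm (Fin n)),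
      ∑ i : Fin n, B ^ ((f (π i, i) : Fin n) : ℕ) = ∑ a : Fin n, B ^ ((a : Fin n) : ℕ))
    {W : ℕ} (P Q : ((Fin n × Fin n) →₀ ℕ) → Prop)
    {F G : Fin W → MvPolynomial (Fin n × Fin n) ℝ≥0}
    (hp : ∑ t, F t * G t ≠ 0) (hF : ∀ t, ∀ mm ∈ (F t).support, P mm)
    (hG : ∀ t, ∀ mm ∈ (G t).support, Q mm) :
    ∃ F' G' : Fin W → MvPolynomial (Fin n × Fin n) ℝ≥0,
      (∀ t, ∀ mm ∈ (F' t).support, P mm) ∧ (∀ t, ∀ mm ∈ (G' t).support, Q mm) ∧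
      ∑ t, F' t * G' t ≠ 0 ∧ (∑ t, F' t * G' t).support ⊆ (∑ t, F t * G t).support ∧
      (∀ m ∈ (∑ t, F' t * G' t).support, ∀ m' ∈ (∑ t, F' t * G' t).support,
        Finsupp.mapDomain f m = Finsupp.mapDomain f m') ∧
      complexity (perPoly (Fin n) ℝ≥0 * ∑ t, F' t * G' t) ≤
        complexity (perPoly (Fin n) ℝ≥0 * ∑ t, F t * G t) ∧
      complexity (∑ t, F' t * G' t) ≤ complexity (∑ t, F t * G t) := by
  obtain ⟨F', G', hF', hG', heq⟩ := exists_rowSplit_topComponent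
    (fun v => ((∑ t, F t * G t).totalDegree + 1) ^ ((f v : Fin n) : ℕ)) F G
  refine ⟨F', G', fun t mm hmm => hF t mm (hF' t hmm), fun t mm hmm => hG t mm (hG' t hmm), ?_⟩
  rw [← heq]
  set p := ∑ t, F t * G t
  set Wt : Fin n × Fin n → ℕ := fun v => (p.totalDegree + 1) ^ ((f v : Fin n) : ℕ)
  refine ⟨topComponent_ne_zero Wt hp, support_topComponent_subset Wt p,
    fun m hm m' hm' => mapDomain_eq_of_mem_support_topComponent f p hm hm', ?_,
    complexity_topComponent_le Wt p⟩
  have := complexity_topComponent_le Wt (perPoly (Fin n) ℝ≥0 * p)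
  rwa [topComponent_mul, topComponent_eq_self_of_isWeightedHomogeneous Wt
    (isWeightedHomogeneous_perPoly_digitWeight f _ (hf _))] at this

/-! ### `Y`-contents of a torus-homogeneous cell-split sum -/

/-- For a monomial `a` on the cells of `Y` plus a monomial `b` off the cells of `Y`, the row
content of `a + b` over the cells of `Y` in row `r` is the row margin of `a` at `r`: `b` vanishes
on `Y` and `a` vanishes off `Y` (`rowDegrees_apply`). [folklore] -/
theorem rowContent_add_of_cellSplit (Y : Finset (Fin n × Fin n)) {a b : (Fin n × Fin n) →₀ ℕ}
    (ha : ∀ e ∈ a.support, e ∈ Y) (hb : ∀ e ∈ b.support, e ∉ Y) (r : Fin n) :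
    ∑ cc ∈ Finset.univ.filter (fun cc : Fin n => (r, cc) ∈ Y), (a + b) (r, cc) =
      rowDegrees a r := by
  rw [rowDegrees_apply, Finset.sum_filter]
  refine Finset.sum_congr rfl fun cc _ => ?_
  split_ifs with h
  · rw [Finsupp.add_apply, Finsupp.notMem_support_iff.mp fun h' => hb _ h' h, add_zero]
  · exact (Finsupp.notMem_support_iff.mp fun h' => h (ha _ h')).symm

/-- For a monomial `a` on the cells of `Y` plus a monomial `b` off the cells of `Y`, the column
content of `a + b` over the cells of `Y` in column `cc` is the column margin of `a` at `cc`
(`colDegrees_apply`). [folklore] -/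
theorem colContent_add_of_cellSplit (Y : Finset (Fin n × Fin n)) {a b : (Fin n × Fin n) →₀ ℕ}
    (ha : ∀ e ∈ a.support, e ∈ Y) (hb : ∀ e ∈ b.support, e ∉ Y) (cc : Fin n) :
    ∑ r ∈ Finset.univ.filter (fun r : Fin n => (r, cc) ∈ Y), (a + b) (r, cc) =
      Finsupp.mapDomain Prod.snd a cc := by
  rw [colDegrees_apply, Finset.sum_filter]
  refine Finset.sum_congr rfl fun r _ => ?_
  split_ifs with h
  · rw [Finsupp.add_apply, Finsupp.notMem_support_iff.mp fun h' => hb _ h' h, add_zero]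
  · exact (Finsupp.notMem_support_iff.mp fun h' => h (ha _ h')).symm

/-- **The `Y`-content `Φ_Y` is constant on the support of a cell-split product `P · Q` inside a
polynomial `H` with constant row margins and constant column margins** (`P` on the cells of `Y`,
`Q` off the cells of `Y`): for monomials `a + b`, `a' + b'` of `P · Q` the cross sum `a' + b` is a
monomial of `P · Q ⊆ H` too (`support_mul_eq`, no cancellation over `ℝ≥0`), so `a` and `a'` have
the same margins (`rowDegrees_add`, `Finsupp.mapDomain_add`, cancellation in `ℕ^n`), and the
`Y`-content of `a + b` is the pair of margin vectors of `a` (`rowContent_add_of_cellSplit`,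
`colContent_add_of_cellSplit`). [folklore] -/
theorem cellContentPair_const_on_summand (Y : Finset (Fin n × Fin n))
    {P Q H : MvPolynomial (Fin n × Fin n) ℝ≥0} (hPQ : (P * Q).support ⊆ H.support)
    (hH : ∀ m ∈ H.support, ∀ m' ∈ H.support,
      rowDegrees m = rowDegrees m' ∧ Finsupp.mapDomain Prod.snd m = Finsupp.mapDomain Prod.snd m')
    (hP : ∀ mm ∈ P.support, ∀ e ∈ mm.support, e ∈ Y)
    (hQ : ∀ mm ∈ Q.support, ∀ e ∈ mm.support, e ∉ Y)
    {m m' : (Fin n × Fin n) →₀ ℕ} (hm : m ∈ (P * Q).support) (hm' : m' ∈ (P * Q).support) :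
    ((fun r : Fin n => ∑ cc ∈ Finset.univ.filter (fun cc : Fin n => (r, cc) ∈ Y), m (r, cc)),
      (fun cc : Fin n => ∑ r ∈ Finset.univ.filter (fun r : Fin n => (r, cc) ∈ Y), m (r, cc))) =
    ((fun r : Fin n => ∑ cc ∈ Finset.univ.filter (fun cc : Fin n => (r, cc) ∈ Y), m' (r, cc)),
      (fun cc : Fin n => ∑ r ∈ Finset.univ.filter (fun r : Fin n => (r, cc) ∈ Y), m' (r, cc))) := by
  rw [JerrumSnir.support_mul_eq] at hm hm' hPQ
  obtain ⟨a, ha, b, hb, rfl⟩ := Finset.mem_add.mp hm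
  obtain ⟨a', ha', b', hb', rfl⟩ := Finset.mem_add.mp hm'
  obtain ⟨h1, h2⟩ := hH _ (hPQ (Finset.add_mem_add ha hb)) _ (hPQ (Finset.add_mem_add ha' hb))
  rw [rowDegrees_add, rowDegrees_add, add_left_inj] at h1
  rw [Finsupp.mapDomain_add, Finsupp.mapDomain_add, add_left_inj] at h2
  refine Prod.ext (funext fun r => ?_) (funext fun cc => ?_)
  · dsimp only
    rw [rowContent_add_of_cellSplit Y (hP a ha) (hQ b hb),
      rowContent_add_of_cellSplit Y (hP a' ha') (hQ b' hb'), h1]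
  · dsimp only
    rw [colContent_add_of_cellSplit Y (hP a ha) (hQ b hb),
      colContent_add_of_cellSplit Y (hP a' ha') (hQ b' hb'), h2]

/-- **At most `W` values of an invariant that is constant on every summand.**  If `Φ` is
constant on the support of each of the `W` summands `S_t` (over `ℝ≥0`), then `Φ` takes at most
`W` values on the support of `Σ_{t < W} S_t`: every monomial of the sum lies in the support of
some summand (`MvPolynomial.support_sum`). [folklore] -/
theorem card_image_le_of_const_on_summands {σ α : Type*} [DecidableEq α] {W : ℕ}
    (S : Fin W → MvPolynomial σ ℝ≥0) (Φ : (σ →₀ ℕ) → α)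
    (hΦ : ∀ t, ∀ m ∈ (S t).support, ∀ m' ∈ (S t).support, Φ m = Φ m') :
    ((∑ t, S t).support.image Φ).card ≤ W := by
  classical
  -- `Φ` is constant on the support of each summand: pick its value
  have key : ∀ t, ∃ v : Option α, ∀ m ∈ (S t).support, some (Φ m) = v := by
    intro t
    rcases (S t).support.eq_empty_or_nonempty with he | ⟨m₀, hm₀⟩
    · exact ⟨none, fun m hm => by simp [he] at hm⟩
    · exact ⟨some (Φ m₀), fun m hm => congrArg some (hΦ t m hm m₀ hm₀)⟩
  choose φ hφ using key
  calc _ = (((∑ t, S t).support.image Φ).image some).card :=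
        (Finset.card_image_of_injective _ (Option.some_injective α)).symm
    _ ≤ (Finset.univ.image φ).card := by
        refine Finset.card_le_card fun v hv => ?_
        obtain ⟨u, hu, rfl⟩ := Finset.mem_image.mp hv
        obtain ⟨m, hm, rfl⟩ := Finset.mem_image.mp hu
        obtain ⟨t, -, hmt⟩ := Finset.mem_biUnion.mp (MvPolynomial.support_sum hm)
        exact Finset.mem_image.mpr ⟨t, Finset.mem_univ _, (hφ t m hmt).symm⟩
    _ ≤ (Finset.univ : Finset (Fin W)).card := Finset.card_image_le
    _ = W := Finset.card_fin W

/-! ### The stub -/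

/-- **`stub_torusCellSplit` (v14 of line `pair-descent-jss-endpoint` for `PerDivisionHard`).  The
torus normal form WITHIN a cell-split class.**  If `h = Σ_{t < W} f_t · g_t ≠ 0` with every `f_t`
in the variables of the cells of `Y ⊆ [n] × [n]` and every `g_t` in the variables of the other
cells, then some nonzero TORUS-HOMOGENEOUS `h'` whose monomials have at most `W` distinct
`Y`-contents `Φ_Y(m) = (r ↦ Σ_{c : (r,c) ∈ Y} m (r,c), c ↦ Σ_{r : (r,c) ∈ Y} m (r,c))` costs no
more in either monotone complexity: `L(per_n · h') ≤ L(per_n · h)` and `L(h') ≤ L(h)`.  Two torus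
steps within the class (`exists_topComponent_const_margins_split` for `Prod.fst`, then `Prod.snd`;
supports only shrink, so the row margins stay constant), then `Φ_Y` is constant on the support of
every one of the `W` summands (`cellContentPair_const_on_summand`,
`card_image_le_of_const_on_summands`). [folklore] -/
theorem stub_torusCellSplit :
    ∀ (n W : ℕ) (Y : Finset (Fin n × Fin n)) (f g : Fin W → MvPolynomial (Fin n × Fin n) ℝ≥0),
      ∑ t, f t * g t ≠ 0 →
      (∀ t, ∀ mm ∈ (f t).support, ∀ e ∈ mm.support, e ∈ Y) →
      (∀ t, ∀ mm ∈ (g t).support, ∀ e ∈ mm.support, e ∉ Y) →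
      ∃ h' : MvPolynomial (Fin n × Fin n) ℝ≥0, h' ≠ 0 ∧ IsTorusHomogeneous h' ∧
        (h'.support.image fun (mm : (Fin n × Fin n) →₀ ℕ) =>
            ((fun r : Fin n =>
                ∑ cc ∈ Finset.univ.filter (fun cc : Fin n => (r, cc) ∈ Y), mm (r, cc)),
              (fun cc : Fin n =>
                ∑ r ∈ Finset.univ.filter (fun r : Fin n => (r, cc) ∈ Y), mm (r, cc)))).card ≤ W ∧
        complexity (perPoly (Fin n) ℝ≥0 * h') ≤
          complexity (perPoly (Fin n) ℝ≥0 * ∑ t, f t * g t) ∧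
        complexity h' ≤ complexity (∑ t, f t * g t) := by
  intro n W Y f g hh hf hg
  -- row step: `per` is row-homogeneous since `i ↦ π i` is a bijection
  obtain ⟨f₁, g₁, hf₁, hg₁, hh₁, -, hrow, hle₁, hle₁'⟩ :=
    exists_topComponent_const_margins_split Prod.fst
      (fun B π => Equiv.sum_comp π (fun a : Fin n => B ^ ((a : Fin n) : ℕ)))
      (fun mm => ∀ e ∈ mm.support, e ∈ Y) (fun mm => ∀ e ∈ mm.support, e ∉ Y) hh hf hg
  -- column step: `per` is column-homogeneous trivially
  obtain ⟨f₂, g₂, hf₂, hg₂, hh₂, hsub, hcol, hle₂, hle₂'⟩ :=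
    exists_topComponent_const_margins_split Prod.snd (fun B π => rfl)
      (fun mm => ∀ e ∈ mm.support, e ∈ Y) (fun mm => ∀ e ∈ mm.support, e ∉ Y) hh₁ hf₁ hg₁
  obtain ⟨d₀, hd₀⟩ := exists_coeff_ne_zero hh₂
  have hd₀s : d₀ ∈ (∑ t, f₂ t * g₂ t).support := mem_support_iff.mpr hd₀
  have htor : ∀ m ∈ (∑ t, f₂ t * g₂ t).support, ∀ m' ∈ (∑ t, f₂ t * g₂ t).support,
      rowDegrees m = rowDegrees m' ∧
        Finsupp.mapDomain Prod.snd m = Finsupp.mapDomain Prod.snd m' :=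
    fun m hm m' hm' => ⟨hrow m (hsub hm) m' (hsub hm'), hcol m hm m' hm'⟩
  exact ⟨∑ t, f₂ t * g₂ t, hh₂,
    ⟨rowDegrees d₀, Finsupp.mapDomain Prod.snd d₀, fun m hm => htor m hm d₀ hd₀s⟩,
    card_image_le_of_const_on_summands _ _ fun t m hm m' hm' =>
      cellContentPair_const_on_summand Y
        (support_summand_subset Finset.univ (fun i => f₂ i * g₂ i) (Finset.mem_univ t))
        htor (hf₂ t) (hg₂ t) hm hm',
    hle₂.trans hle₁, hle₂'.trans hle₁'⟩

end Summit.ValiantsHypothesis.ValiantsHypothesis.Theorems.DivisionGapPerDivisionHard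

end
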